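import Summits.BirchSwinnertonDyer.BirchSwinnertonDyer.Theorems.PrintCf2SplitBadTwoCMShaEigenImage
import Summits.BirchSwinnertonDyer.BirchSwinnertonDyer.Theorems.PrintCf2SplitBadTwoRestrictedSelmerBottomShaEigenAssembly
import Summits.BirchSwinnertonDyer.BirchSwinnertonDyer.Theorems.PrintCf2SplitBadTwoCMShaDescentSquare
import Summits.BirchSwinnertonDyer.BirchSwinnertonDyer.Theorems.PrintCf2SplitBadTwoRestrictedSelmerBottomValueOfFactors
import Summits.BirchSwinnertonDyer.BirchSwinnertonDyer.Theorems.PrintCf2SplitBadTwoCMPrimaryConjugationTransport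
import HarnessLib

/-!
# Crux `PrintCf2.SplitBadTwoRankOneOfFacts` (item stmt-BirchSwinnertonDyer-20368), road α, S3c₂ bottom value: factor (F2) ON THE FRAME
# modulo the SINGLE CM input (H1″) at `v`

Cell `bsd-print-cf2`, width seat `bsd-line-cf2-p1-w8` g2 (brick **B6f**, assembly in -w7 g2's final currency); `--supports stmt-BirchSwinnertonDyer-20368`
(helper, Theses-free). HONEST FRAMING: nothing here closes a crux or a stub; BSD is not proved by any of this; no summit statement is proved by
this seat. No definition, no named fact, no `sorry`. beyond-print theorem: no.

WHAT THIS FILE DOES. It joins the two (F2) lanes: -w7 g2's `RestrictedSelmerPair.mem_range_shaMap_trueSelmer_of_eigen` (p668690: every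
`r`-eigen class of `P(Sel_{p^∞}(E_K/K))` lies in `f(𝔖_v(K, M) ⊓ L_M)`, GRANTED `HasLocalPointsMaps` — a THEOREM for isogenies,
`Isogeny.hasLocalPointsMaps_toAddMonoidHom` — and the CM input (H1″) `ι_*⁻¹(localKerOver p ⊤ K_v) ≤ ker res_{⊤ ⊓ D_v}`) with this seat's
injection `CMPrimes.exists_injective_range_shaBridge_to_eigen` (p667242) and count `CMPrimes.natCard_cmPrimary_sha_eq_of_isogeny` (p665921):
* §1 `natCard_range_shaBridge_trueSelmer_eq_of_H1` — `#f(𝔖_v ⊓ L_M) = #C` for THE `r`-eigen subgroup `C ≤ Ш(E_K/K)[p^∞]` of an isogeny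
  `φ = π`, over any number field with `p = v·v̄` imaginary quadratic data, modulo (H1″) ONLY (the displayed (Hv), (Hv̄) of p668410 are GONE:
  -w7 g2's Bézout `ι_* e_* y = b • (π_* y₀ − N₂ • y₀)` makes the `M`-component of a Selmer class Selmer);
* §2 `natCard_trueSelmer_quotient_eq_sha_of_frame_of_H1`, `padicValNat_trueSelmer_quotient_eq_sha_of_frame_of_H1` — ON EVERY S3c₂ FRAME
  (member `C • W = cm7^{(d)}`, `d ≠ 0`, `K` imaginary quadratic, `2 = v·v̄`, `π ∈ End_K(E_K)`, `π² = π − 2`, `r² = r − 2`):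
  **`v₂ #((𝔖_v(K, E[𝔮_r^∞]) ⊓ L_M) ⧸ Q_M) = v₂ #Ш(W/ℚ)[2^∞]`** — the inner statement of hypothesis `hF2` of `rBV_of_three_factor_values`,
  VERBATIM, from the frame data and (H1″) alone.
So factor (F2) of (R-BV) is reduced, in the kernel, to the one local CM input (H1″) at `v` («the `E[𝔮_r^∞]`-part of the local Kummer image at
`v` vanishes», Greenberg's `Im κ_v ⊆ Im H¹(K_v, E[v^∞])` for the potentially ordinary twist — T4 of the cell's plan).

References: A. Agboola, Compositio 143 (2007) §6 Props. 6.10–6.11 [Agboola2007]; B. Gross, LMS LN 153 (1991) §5 [GrossLMS1991];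
R. Greenberg, LNM 1716 (1999) §2 [GreenbergLNM1716]; K. Rubin, LNM 1716 (1999) §2 [Rubin1999].
-/

noncomputable section

open scoped Classical

set_option linter.dupNamespace false
set_option autoImplicit false

namespace Summit.BirchSwinnertonDyer.BirchSwinnertonDyer.Theorems.PrintCf2.CMPrimes

open Literature.NumberTheory.EllipticCurves Literature.NumberTheory.GaloisRepresentations Field NumberField IsDedekindDomain
open Literature.NumberTheory.EllipticCurves.ResKernel Literature.NumberTheory.EllipticCurves.GreenbergSelmer
open Literature.NumberTheory.EllipticCurves.Agboola2007
open Summit.BirchSwinnertonDyer.BirchSwinnertonDyer.Theorems.PrintCf2.RestrictedSelmerPair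
open Summit.BirchSwinnertonDyer.BirchSwinnertonDyer.Theorems.PrintCf2.AdditiveAtSeven

universe u

/-! ## §1 `#f(𝔖_v ⊓ L_M) = #C` modulo (H1″) only -/

section Generic

variable {K : Type u} [Field K] [NumberField K] (V : WeierstrassCurve K) [V.IsElliptic] (p : ℕ) [Fact p.Prime]
  (π : V.endRing) (r : ℤ_[p]) (v vbar : HeightOneSpectrum (𝓞 K))

/-- **`#f(𝔖_v(K, E[𝔮_r^∞]) ⊓ L_M) = #C` modulo (H1″).** `K` imaginary quadratic with `p = v·v̄` its only places above `p`, `M = E[𝔮_r^∞]` and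
`M̄ = E[𝔮_{1−r}^∞]` complementary, `r − (1 − r)` a unit, `φ` an isogeny acting as `π`, `C ≤ Ш(E_K/K)[p^∞]` THE `r`-eigen subgroup of `Ш(φ)`,
and (H1″) `ι_*⁻¹(localKerOver p ⊤ K_v) ≤ ker res_{⊤ ⊓ D_v}`: then the bridge `f = P ∘ res_⊤⁻¹ ∘ ι_*` maps the true Selmer group
`𝔖_v(K, M) ⊓ L_M` ONTO `C` (-w7 g2 `mem_range_shaMap_trueSelmer_of_eigen`) and injectively (p667242), so `#f(𝔖_v ⊓ L_M) = #C` (`Nat.card`).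
[cite: Agboola2007, Props. 6.10–6.11 (arXiv p0014:L1–p0015:L12)] [cite: Rubin1999, §2] -/
theorem natCard_range_shaBridge_trueSelmer_eq_of_H1 (hK : IsImaginaryQuadratic K)
    (hall : ∀ w : HeightOneSpectrum (𝓞 K), ((p : ℕ) : 𝓞 K) ∈ w.asIdeal → w = v ∨ w = vbar)
    (hinf : V.endEigenPrimaryTorsion p π r ⊓ V.endEigenPrimaryTorsion p π (1 - r) = ⊥)
    (hsup : V.endEigenPrimaryTorsion p π r ⊔ V.endEigenPrimaryTorsion p π (1 - r) = ⊤) (hunit : IsUnit (r - (1 - r)))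
    (φ : WeierstrassCurve.Isogeny V V) (hφ : ∀ P, φ P = (π : AddMonoid.End V.geomPoints) P)
    (hH1 : (V.localKerOver p ⊤ (v.adicCompletion K)).comap
        (resH1Hom (ContinuousMonoidHom.id _) (V.endEigenPrimaryTorsion p π r).subtype (fun _ _ ↦ rfl)) ≤
      (Literature.NumberTheory.EllipticCurves.resOfLe ↥(V.endEigenPrimaryTorsion p π r) (inf_le_left : ⊤ ⊓ decomp v ≤ ⊤)).ker)
    {C : AddSubgroup (AddCommGroup.primaryComponent V.sha p)}
    (hC : ∀ x, x ∈ C ↔ ∀ (k : ℕ) (N : ℤ), p ^ k • x = 0 →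
      ((N : ℤ_[p]) - r) ∈ (Ideal.span {(p : ℤ_[p]) ^ k} : Ideal ℤ_[p]) →
        galH1Map φ.toAddMonoidHom φ.equivariant (((x : AddCommGroup.primaryComponent V.sha p) : V.sha) : V.galH1) =
          N • (((x : AddCommGroup.primaryComponent V.sha p) : V.sha) : V.galH1)) :
    Nat.card ↥(((V.primaryH1ToH1 p).comp (AddEquiv.ofBijective (resSubgroup (⊤ : Subgroup (absoluteGaloisGroup K)) ↥(V.geomPrimaryTorsion p))
        (resSubgroup_top_bijective ↥(V.geomPrimaryTorsion p))).symm.toAddMonoidHom).comp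
      ((resH1Hom (ContinuousMonoidHom.id _) (V.endEigenPrimaryTorsion p π r).subtype (fun _ _ ↦ rfl)).comp
        (restrictedSelmerBase ↥(V.endEigenPrimaryTorsion p π r) p v ⊓
            (V.localKerOver p ⊤ (vbar.adicCompletion K)).comap
              (resH1Hom (ContinuousMonoidHom.id _) (V.endEigenPrimaryTorsion p π r).subtype (fun _ _ ↦ rfl))).subtype)).range =
      Nat.card ↥C := by
  set S := restrictedSelmerBase ↥(V.endEigenPrimaryTorsion p π r) p v ⊓
    (V.localKerOver p ⊤ (vbar.adicCompletion K)).comap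
      (resH1Hom (ContinuousMonoidHom.id _) (V.endEigenPrimaryTorsion p π r).subtype (fun _ _ ↦ rfl)) with hS
  have hSsha := (natCard_trueSelmer_quotient_eq_natCard_range_shaMap V p π r v vbar hK hall).2
  obtain ⟨ε, hεinj, hεval⟩ := exists_injective_range_shaBridge_to_eigen V p π r S φ hφ hSsha hC
  -- `φ = π` acts as `r` on `M`, as `1 − r` on `M̄`, at every level
  have hfr : ∀ (k : ℕ) (N : ℤ) (x : V.geomPrimaryTorsion p), x ∈ V.endEigenPrimaryTorsion p π r → p ^ k • x = 0 →
      ((N : ℤ_[p]) - r) ∈ (Ideal.span {(p : ℤ_[p]) ^ k} : Ideal ℤ_[p]) →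
        φ.toAddMonoidHom (x : V.geomPoints) = N • (x : V.geomPoints) := fun k N x hx hk hN ↦ by
    rw [show φ.toAddMonoidHom (x : V.geomPoints) = φ (x : V.geomPoints) from rfl, hφ]
    exact (eigen_of_endRing V p π r).2 k N x hx hk hN
  have hfr' : ∀ (k : ℕ) (N : ℤ) (x : V.geomPrimaryTorsion p), x ∈ V.endEigenPrimaryTorsion p π (1 - r) → p ^ k • x = 0 →
      ((N : ℤ_[p]) - (1 - r)) ∈ (Ideal.span {(p : ℤ_[p]) ^ k} : Ideal ℤ_[p]) →
        φ.toAddMonoidHom (x : V.geomPoints) = N • (x : V.geomPoints) := fun k N x hx hk hN ↦ by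
    rw [show φ.toAddMonoidHom (x : V.geomPoints) = φ (x : V.geomPoints) from rfl, hφ]
    exact (eigen_of_endRing V p π (1 - r)).2 k N x hx hk hN
  refine Nat.card_congr (Equiv.ofBijective ε ⟨hεinj, fun z ↦ ?_⟩)
  -- surjectivity: `z ∈ C` is an `r`-eigen class of `P(Sel)` (`Ш[p^∞] ⊆ Ш ⊓ im P = P(Sel)`), hence in the range (-w7 g2)
  have hzprim : (((z : AddCommGroup.primaryComponent V.sha p) : V.sha) : V.galH1) ∈ AddCommGroup.primaryComponent V.galH1 p := by
    obtain ⟨n, hn⟩ := (AddCommGroup.mem_primaryComponent).mp (z : AddCommGroup.primaryComponent V.sha p).2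
    refine (AddCommGroup.mem_primaryComponent).mpr ⟨n, ?_⟩
    have h := congrArg (fun y : V.sha ↦ (y : V.galH1)) hn
    simpa using h
  have hzSel : (((z : AddCommGroup.primaryComponent V.sha p) : V.sha) : V.galH1) ∈ (V.selmerGroupPInfty p).map (V.primaryH1ToH1 p) := by
    rw [V.map_primaryH1ToH1_selmerGroupPInfty_eq_sha_inf_range p]
    exact AddSubgroup.mem_inf.mpr ⟨((z : AddCommGroup.primaryComponent V.sha p) : V.sha).2,
      WeierstrassCurve.primaryComponent_le_range_primaryH1ToH1 V p V.zsmul_geomPoints_surjective_holds hzprim⟩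
  have hzEig : ∀ (k : ℕ) (N : ℤ), p ^ k • (((z : AddCommGroup.primaryComponent V.sha p) : V.sha) : V.galH1) = 0 →
      ((N : ℤ_[p]) - r) ∈ (Ideal.span {(p : ℤ_[p]) ^ k} : Ideal ℤ_[p]) →
        galH1Map φ.toAddMonoidHom φ.equivariant (((z : AddCommGroup.primaryComponent V.sha p) : V.sha) : V.galH1) =
          N • (((z : AddCommGroup.primaryComponent V.sha p) : V.sha) : V.galH1) := fun k N hk hN ↦
    (hC z).mp z.2 k N (Subtype.ext (Subtype.ext (by simpa only [AddSubmonoidClass.coe_nsmul, ZeroMemClass.coe_zero] using hk))) hN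
  have hmem := mem_range_shaMap_trueSelmer_of_eigen V p π r (1 - r) v vbar φ.toAddMonoidHom φ.equivariant hfr hfr' hK hinf hsup hunit
    φ.hasLocalPointsMaps_toAddMonoidHom hH1 hzSel hzEig
  obtain ⟨⟨c, hc⟩, hcz⟩ := hmem
  refine ⟨⟨_, ⟨⟨c, hc⟩, rfl⟩⟩, ?_⟩
  apply Subtype.ext; apply Subtype.ext; apply Subtype.ext
  rw [hεval]
  exact hcz

end Generic

/-! ## §2 Factor (F2) on the frame, modulo (H1″) only -/

section Frame

variable {K : Type} [Field K] [NumberField K]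

/-- **Factor (F2) on the frame, `Nat.card` form, modulo (H1″) only.** For a member `C • W = cm7^{(d)}` (`d ≠ 0`) over an imaginary quadratic
`K` with `2 = v·v̄` (`v̄ ≠ v`), `π ∈ End_K(E_K)` with `π² = π − 2`, `r² = r − 2`, and `M = E[𝔮_r^∞]`: GRANTED (H1″)
`ι_*⁻¹(localKerOver 2 ⊤ K_v) ≤ ker res_{⊤ ⊓ D_v}`, `#((𝔖_v(K, M) ⊓ L_M) ⧸ Q_M) = #Ш(W/ℚ)[2^∞]` (`Nat.card`, no finiteness assumed).
[cite: Agboola2007, Props. 6.10–6.11 (arXiv p0014:L1–p0015:L12)] [cite: GrossLMS1991, §5 (5.1)] -/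
theorem natCard_trueSelmer_quotient_eq_sha_of_frame_of_H1 {d : ℤ} (hd0 : d ≠ 0) (W : WeierstrassCurve ℚ) [W.IsElliptic]
    (C : WeierstrassCurve.VariableChange ℚ) (hCW : C • W = cm7.quadraticTwist (d : ℚ)) (hK : IsImaginaryQuadratic K)
    (v vbar : HeightOneSpectrum (𝓞 K)) (hv : ((2 : ℕ) : 𝓞 K) ∈ v.asIdeal) (hvbar : ((2 : ℕ) : 𝓞 K) ∈ vbar.asIdeal) (hne : vbar ≠ v)
    (π : (W.baseChange K).endRing) (hrel : (π : AddMonoid.End (W.baseChange K).geomPoints) * π = π - 2)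
    {r : ℤ_[2]} (hr : r * r = r - 2)
    (hH1 : ((W.baseChange K).localKerOver 2 ⊤ (v.adicCompletion K)).comap
        (resH1Hom (ContinuousMonoidHom.id _) ((W.baseChange K).endEigenPrimaryTorsion 2 π r).subtype (fun _ _ ↦ rfl)) ≤
      (Literature.NumberTheory.EllipticCurves.resOfLe ↥((W.baseChange K).endEigenPrimaryTorsion 2 π r)
        (inf_le_left : ⊤ ⊓ decomp v ≤ ⊤)).ker) :
    Nat.card (↥(restrictedSelmerBase ↥((W.baseChange K).endEigenPrimaryTorsion 2 π r) 2 v ⊓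
            (((W.baseChange K).localKerOver 2 ⊤ (vbar.adicCompletion K)).comap
          (resH1Hom (ContinuousMonoidHom.id _) ((W.baseChange K).endEigenPrimaryTorsion 2 π r).subtype (fun _ _ ↦ rfl)))) ⧸
          (((((W.baseChange K).kummerMapPInfty 2 (W.baseChange K).zsmul_geomPoints_surjective_holds).range).map
            (resSubgroup ⊤ ((W.baseChange K).geomPrimaryTorsion 2))).comap
          (resH1Hom (ContinuousMonoidHom.id _) ((W.baseChange K).endEigenPrimaryTorsion 2 π r).subtype (fun _ _ ↦ rfl))).addSubgroupOf
            (restrictedSelmerBase ↥((W.baseChange K).endEigenPrimaryTorsion 2 π r) 2 v ⊓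
              (((W.baseChange K).localKerOver 2 ⊤ (vbar.adicCompletion K)).comap
          (resH1Hom (ContinuousMonoidHom.id _) ((W.baseChange K).endEigenPrimaryTorsion 2 π r).subtype (fun _ _ ↦ rfl))))) =
      Nat.card (AddCommGroup.primaryComponent W.sha 2) := by
  -- the frame's supplies
  have hπg : (π : AddMonoid.End (W.baseChange K).geomPoints) ∈ (W.baseChange K).geomEndRing :=
    (W.baseChange K).endRing_le_geomEndRing π.2
  have hπG : ∀ (g : absoluteGaloisGroup K) (P : (W.baseChange K).geomPoints),
      (π : AddMonoid.End (W.baseChange K).geomPoints) (g • P) = g • (π : AddMonoid.End (W.baseChange K).geomPoints) P :=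
    ((W.baseChange K).mem_equivariantSubring_iff _).mp (Subring.mem_inf.mp π.2).2
  obtain ⟨φ, hφ, hrelφ⟩ := exists_isogeny_apply_eq_cmEndo (W.baseChange K) hπg hπG hrel
  obtain ⟨hinf, hsup⟩ := endEigenPrimaryTorsion_compl_of_frame hd0 W C hCW K π hrel hr
  have hunit : IsUnit (r - (1 - r)) := (two_dvd_or_two_dvd_one_sub_of_root hr).2
  have hall : ∀ w : HeightOneSpectrum (𝓞 K), ((2 : ℕ) : 𝓞 K) ∈ w.asIdeal → w = v ∨ w = vbar :=
    fun w hw ↦ eq_or_eq_of_two_mem K hK.1 hv hvbar hne hw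
  obtain ⟨θ, hθ⟩ := exists_sq_eq_neg_seven_of_frame_cmEndo hd0 W C hCW π hrel
  have hj : W.j = -3375 := j_eq_of_smul_eq_cm7Twist hd0 W C hCW
  -- THE `r`-eigen subgroup of `Ш(E_K/K)[2^∞]` and its partner
  obtain ⟨πM, hπM, -⟩ := exists_shaPi_two (W.baseChange K) φ hrelφ
  obtain ⟨C₁, hC₁⟩ := exists_addSubgroup_eigen (p := 2) exists_two_pow_smul_eq_zero_primaryComponent πM r
  obtain ⟨C₂, hC₂⟩ := exists_addSubgroup_eigen (p := 2) exists_two_pow_smul_eq_zero_primaryComponent πM (1 - r)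
  have hcoe : ∀ (x : ↥(AddCommGroup.primaryComponent (W.baseChange K).sha 2)) (N : ℤ), πM x = N • x ↔
      galH1Map φ.toAddMonoidHom φ.equivariant
          (((x : ↥(AddCommGroup.primaryComponent (W.baseChange K).sha 2)) : (W.baseChange K).sha) : (W.baseChange K).galH1) =
        N • (((x : ↥(AddCommGroup.primaryComponent (W.baseChange K).sha 2)) : (W.baseChange K).sha) : (W.baseChange K).galH1) :=
    fun x N ↦ by
    rw [← hπM x]
    constructor
    · intro h; rw [h, AddSubgroupClass.coe_zsmul, AddSubgroupClass.coe_zsmul]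
    · intro h
      apply Subtype.ext; apply Subtype.ext
      rw [h, AddSubgroupClass.coe_zsmul, AddSubgroupClass.coe_zsmul]
  have hC : ∀ x : ↥(AddCommGroup.primaryComponent (W.baseChange K).sha 2), x ∈ C₁ ↔ ∀ (k : ℕ) (N : ℤ), 2 ^ k • x = 0 →
      ((N : ℤ_[2]) - r) ∈ (Ideal.span {(2 : ℤ_[2]) ^ k} : Ideal ℤ_[2]) →
        galH1Map φ.toAddMonoidHom φ.equivariant
            (((x : ↥(AddCommGroup.primaryComponent (W.baseChange K).sha 2)) : (W.baseChange K).sha) : (W.baseChange K).galH1) =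
          N • (((x : ↥(AddCommGroup.primaryComponent (W.baseChange K).sha 2)) : (W.baseChange K).sha) : (W.baseChange K).galH1) :=
    fun x ↦ by
    rw [hC₁ x]
    exact forall_congr' fun k ↦ forall_congr' fun N ↦ forall_congr' fun _ ↦ forall_congr' fun _ ↦ hcoe x N
  have hC' : ∀ x : ↥(AddCommGroup.primaryComponent (W.baseChange K).sha 2), x ∈ C₂ ↔ ∀ (k : ℕ) (N : ℤ), 2 ^ k • x = 0 →
      ((N : ℤ_[2]) - (1 - r)) ∈ (Ideal.span {(2 : ℤ_[2]) ^ k} : Ideal ℤ_[2]) →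
        galH1Map φ.toAddMonoidHom φ.equivariant
            (((x : ↥(AddCommGroup.primaryComponent (W.baseChange K).sha 2)) : (W.baseChange K).sha) : (W.baseChange K).galH1) =
          N • (((x : ↥(AddCommGroup.primaryComponent (W.baseChange K).sha 2)) : (W.baseChange K).sha) : (W.baseChange K).galH1) :=
    fun x ↦ by
    rw [hC₂ x]
    exact forall_congr' fun k ↦ forall_congr' fun N ↦ forall_congr' fun _ ↦ forall_congr' fun _ ↦ hcoe x N
  -- the three counts
  have h1 := (natCard_trueSelmer_quotient_eq_natCard_range_shaMap (W.baseChange K) 2 π r v vbar hK hall).1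
  have h2 := natCard_range_shaBridge_trueSelmer_eq_of_H1 (W.baseChange K) 2 π r v vbar hK hall hinf hsup hunit φ hφ hH1 hC
  have h3 := (natCard_cmPrimary_sha_eq_of_isogeny W hj hK hθ φ hrelφ hr hC hC').1
  exact h1.trans (h2.trans h3)

/-- **Factor (F2) on the frame, `v₂` form, modulo (H1″) only — the inner statement of hypothesis `hF2` of -w7 g2's
`rBV_of_three_factor_values`, VERBATIM**: `v₂ #((𝔖_v(K, E[𝔮_r^∞]) ⊓ L_M) ⧸ Q_M) = v₂ #Ш(W/ℚ)[2^∞]`.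
[cite: Agboola2007, Props. 6.10–6.11 (arXiv p0014:L1–p0015:L12)] [cite: GrossLMS1991, §5 (5.1)] -/
theorem padicValNat_trueSelmer_quotient_eq_sha_of_frame_of_H1 {d : ℤ} (hd0 : d ≠ 0) (W : WeierstrassCurve ℚ) [W.IsElliptic]
    (C : WeierstrassCurve.VariableChange ℚ) (hCW : C • W = cm7.quadraticTwist (d : ℚ)) (hK : IsImaginaryQuadratic K)
    (v vbar : HeightOneSpectrum (𝓞 K)) (hv : ((2 : ℕ) : 𝓞 K) ∈ v.asIdeal) (hvbar : ((2 : ℕ) : 𝓞 K) ∈ vbar.asIdeal) (hne : vbar ≠ v)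
    (π : (W.baseChange K).endRing) (hrel : (π : AddMonoid.End (W.baseChange K).geomPoints) * π = π - 2)
    {r : ℤ_[2]} (hr : r * r = r - 2)
    (hH1 : ((W.baseChange K).localKerOver 2 ⊤ (v.adicCompletion K)).comap
        (resH1Hom (ContinuousMonoidHom.id _) ((W.baseChange K).endEigenPrimaryTorsion 2 π r).subtype (fun _ _ ↦ rfl)) ≤
      (Literature.NumberTheory.EllipticCurves.resOfLe ↥((W.baseChange K).endEigenPrimaryTorsion 2 π r)
        (inf_le_left : ⊤ ⊓ decomp v ≤ ⊤)).ker) :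
    padicValNat 2 (Nat.card (↥(restrictedSelmerBase ↥((W.baseChange K).endEigenPrimaryTorsion 2 π r) 2 v ⊓
            (((W.baseChange K).localKerOver 2 ⊤ (vbar.adicCompletion K)).comap
          (resH1Hom (ContinuousMonoidHom.id _) ((W.baseChange K).endEigenPrimaryTorsion 2 π r).subtype (fun _ _ ↦ rfl)))) ⧸
          (((((W.baseChange K).kummerMapPInfty 2 (W.baseChange K).zsmul_geomPoints_surjective_holds).range).map
            (resSubgroup ⊤ ((W.baseChange K).geomPrimaryTorsion 2))).comap
          (resH1Hom (ContinuousMonoidHom.id _) ((W.baseChange K).endEigenPrimaryTorsion 2 π r).subtype (fun _ _ ↦ rfl))).addSubgroupOf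
            (restrictedSelmerBase ↥((W.baseChange K).endEigenPrimaryTorsion 2 π r) 2 v ⊓
              (((W.baseChange K).localKerOver 2 ⊤ (vbar.adicCompletion K)).comap
          (resH1Hom (ContinuousMonoidHom.id _) ((W.baseChange K).endEigenPrimaryTorsion 2 π r).subtype (fun _ _ ↦ rfl)))))) =
      padicValNat 2 (Nat.card (AddCommGroup.primaryComponent W.sha 2)) := by
  rw [natCard_trueSelmer_quotient_eq_sha_of_frame_of_H1 hd0 W C hCW hK v vbar hv hvbar hne π hrel hr hH1]

end Frame

end Summit.BirchSwinnertonDyer.BirchSwinnertonDyer.Theorems.PrintCf2.CMPrimes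

end
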